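import Literature.Analysis.FluidPDE.FluidComputer.GalerkinEnergyBalance

/-!
# The enstrophy CURVATURE `Z̈_S` of the Galerkin-truncated Navier–Stokes system at a single-shell instant

HONEST FRAMING (cell `pub-fluidc`, verbatim): *low prior, high value-of-information experiment on
Tao's machine paradigm; NOT a claim that NS blows up.* Like `GalerkinEnergyBalance`, this file says
NOTHING about solutions of the Navier–Stokes PDE: it concerns the finite ODE system that a dealiased
pseudo-spectral code integrates — the Galerkin truncation to a finite mode set `S`
[cite: DoeringGibbon1995, §5.3 eq. (5.3.13)] in the `ShellTransfer.FourierVelocity` vocabulary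
(`IsGalerkinSolution`).

`GalerkinEnergyBalance` (v3) proved the enstrophy equation `Ż_S = -2ν P_S + T_Z + inj` and the
SINGLE-SHELL IDENTITY: at an instant where the field is carried by one shell `|k|² = λ` (every
classical lattice datum of the cell: Taylor–Green `λ = 3`, Kida–Pelz `11`, ABC `1`) the nonlinear
enstrophy production `T_Z` vanishes and `Ż_S = -2νλ Z_S`. That is the FIRST time-derivative of the
engines' G1 enstrophy curves at `t = 0`. This file computes the SECOND: along any unforced Galerkin
solution `U` supported in `S` (`IsSupportedOn`: coefficients off `S` vanish identically, as in a code),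
at a single-shell instant `t`,

  **`Z̈_S(t) = 4ν²λ² Z_S(t) + Σ_{k∈S} (|k|² - λ) |P_k N_S(k)|²`**
  (`hasDerivAt_deriv_truncEnstrophy_singleShell'`; `P_k` the Leray projection `leray`,
  `N_S` the truncated advection term `ShellTransfer.advection`, the sum is `curvatureQ`),

equivalently `Z̈_S = 4ν²λ² Z_S + 2 Z_S(W) - 2λ E_S(W)` with `W = P N_S` the INVISCID RATE FIELD
(`inviscidRate`, `hasDerivAt_deriv_truncEnstrophy_singleShell`). There is NO `O(ν)` cross term: the
viscous part is the pure single-shell decay `Z_S e^{-2νλt}` to second order, and the inviscid part is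
the first appearance of enstrophy production, through the modes `W` excites, weighted by their distance
`|k|² - λ` from the shell. For truncated Euler `Ż_S = 0`, `Z̈_S = Q_S`
(`hasDerivAt_deriv_truncEnstrophy_singleShell_euler`): the enstrophy leaves every classical lattice
datum as an even parabola. [folklore — the computation behind the `T²` coefficient of Taylor & Green's
dissipation series `W'/W'₀ = 1 - 6T/R + (5/48 + 18/R²)T² - …` [cite: TaylorGreen1937, eq. (47) p. 511],
whose Taylor–Green instance is the companion file `TaylorGreenCurvature`.]

The proof, all finite-sum algebra plus the product rule:
* `triTransfer A B C k p = Im[(k·A(k-p))(conj C(k)·B(p))]` — the trilinear polarisation of Verma's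
  mode-to-mode transfer [cite: Verma2004MHDTurbulencePhysRep, §3.1.2] (`triTransfer U U U = modeTransfer U`);
  its antisymmetry under exchanging giving and receiving slots `triTransfer_swap` (incompressibility and
  reality of the MEDIATOR only, as in `modeTransfer_antisymm`), hence `Σ_{k,p∈S} M(A,B,B) = 0`
  (`sum_sum_triTransfer_eq_zero`) and `Σ_p M(A,B,C)(k,p) = Re(conj C(k)·N_S(A,B)(k))`
  (`sum_triTransfer_eq_re_cdot`); linearity in each slot for real scalars (`addSmul`, `triTransfer_addSmul_*`);
* the DERIVATIVE FIELD `U̇` of a supported solution is itself a `FourierVelocity` (`rateField`): reality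
  and incompressibility pass to the time derivative by uniqueness of derivatives (`rateFun_reality`,
  `rateFun_divFree` — the latter is what determines the pressure multiplier, `pressure_mul_knormSq`:
  `c(k)|k|² = k·N_S(k)` [cite: DoeringGibbon1995, §5.3 (5.3.14)]);
* `hasDerivAt_modeTransfer`: `d/dt M(U,U,U) = M(U̇,U,U) + M(U,U̇,U) + M(U,U,U̇)`, hence
  `hasDerivAt_enstrophyTransfer`, and `hasDerivAt_truncPalinstrophy` (the `|k|⁴`-moment of the modal
  energy equation [cite: Verma2004MHDTurbulencePhysRep, §3.4]);
* at a single-shell instant write `U̇ = -νλU + W` (`inviscidRate`; on `S`, `W(k) = N_S(k) - c(k)k =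
  P_k N_S(k)`: `inviscidRate_coeff_of_mem`, `inviscidRate_coeff_eq_leray`); the three polarised sums are
  `Σ|k|²Σ M(W,U,U) = 0`, `Σ|k|²Σ M(U,W,U) = -2λ E_S(W)`, `Σ|k|²Σ M(U,U,W) = 2 Z_S(W)`
  (`sum_triTransfer_rate_left/mid/right`: single-shell weights `|k|² ↦ λ`, then detailed conservation /
  the slot exchange / `Re(conj W·N_S) = |W|²`), the `-νλU` parts give `-3νλ T_Z = 0`, and
  `Ṗ_S = -2νλ² Z_S` (`hasDerivAt_truncPalinstrophy_singleShell`).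

NOT covered: existence of Galerkin solutions, anything at `N → ∞`, higher derivatives, the physical-space
(Parseval) form `T_Z = ⟨ω·S·ω⟩`. No named facts (D-0026).
-/

noncomputable section

namespace Literature.Analysis.FluidPDE.FluidComputer

open Complex ComplexConjugate Finset Real
open scoped BigOperators

namespace ShellTransfer

/-! ## Trilinear transfer: three coefficient fields in the three slots of `modeTransfer` -/

/-- The BILINEAR truncated advection term `N_S(A,B)(k)_j = -i Σ_{p∈S} (k·A(k-p)) B_j(p)`
(field `A` advects field `B`); `N_S(U,U) = ShellTransfer.advection U S`. [folklore] -/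
def biAdvection (A B : FourierVelocity) (S : Finset (Fin 3 → ℤ)) (k : Fin 3 → ℤ) : Fin 3 → ℂ :=
  fun j => -I * ∑ p ∈ S, kdot k (A.coeff (k - p)) * B.coeff p j

/-- `N_S(U,U) = N_S(U)`. [folklore] -/
theorem biAdvection_self (U : FourierVelocity) (S : Finset (Fin 3 → ℤ)) (k : Fin 3 → ℤ) :
    biAdvection U U S k = advection U S k := rfl

/-- The TRILINEAR mode-to-mode transfer `Im[(k·A(k-p)) (conj C(k) · B(p))]`: rate into mode `k` of
the field `C` from mode `p` of the field `B`, mediated by `A(k-p)`; `triTransfer U U U = modeTransfer U`.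
(This is the polarisation of Verma's `S(k|p|q)` that appears when `modeTransfer` is differentiated
in time along a solution.) [folklore] -/
def triTransfer (A B C : FourierVelocity) (k p : Fin 3 → ℤ) : ℝ :=
  (kdot k (A.coeff (k - p)) * cdot (fun i => conj (C.coeff k i)) (B.coeff p)).im

/-- `triTransfer U U U = modeTransfer U`. [folklore] -/
theorem triTransfer_self (U : FourierVelocity) (k p : Fin 3 → ℤ) :
    triTransfer U U U k p = modeTransfer U k p := rfl

/-- **Antisymmetry of the trilinear transfer** under exchanging the receiving and the giving
slot together with the two modes: `M(A,C,B)(p,k) = -M(A,B,C)(k,p)` — incompressibility of the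
MEDIATOR field `A` (`k·A(k-p) = p·A(k-p)`) and its reality (`A(p-k) = conj A(k-p)`), exactly as in
`modeTransfer_antisymm`. [cite: Verma2004MHDTurbulencePhysRep, §3.1.1–3.1.2] -/
theorem triTransfer_swap (A B C : FourierVelocity) (k p : Fin 3 → ℤ) :
    triTransfer A C B p k = -triTransfer A B C k p := by
  unfold triTransfer
  rw [coeff_sub_swap A k p, kdot_conj, ← kdot_mediator A k p, cdot_conj_swap (B.coeff p) (C.coeff k),
    ← map_mul, Complex.conj_im]

/-- Summed over a common finite set in both modes, exchanging the giving and receiving fields flips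
the sign: `Σ_{k,p∈S} M(A,B,C)(k,p) = -Σ_{k,p∈S} M(A,C,B)(k,p)`. [folklore] -/
theorem sum_sum_triTransfer_swap (A B C : FourierVelocity) (S : Finset (Fin 3 → ℤ)) :
    ∑ k ∈ S, ∑ p ∈ S, triTransfer A B C k p = -∑ k ∈ S, ∑ p ∈ S, triTransfer A C B k p := by
  conv_rhs => rw [Finset.sum_comm]
  rw [← Finset.sum_neg_distrib]
  refine Finset.sum_congr rfl fun k _ => ?_
  rw [← Finset.sum_neg_distrib]
  refine Finset.sum_congr rfl fun p _ => ?_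
  linarith [triTransfer_swap A B C k p]

/-- In particular with the same field giving and receiving the double sum vanishes (detailed
conservation, polarised in the mediator): `Σ_{k,p∈S} M(A,B,B)(k,p) = 0`. [folklore] -/
theorem sum_sum_triTransfer_eq_zero (A B : FourierVelocity) (S : Finset (Fin 3 → ℤ)) :
    ∑ k ∈ S, ∑ p ∈ S, triTransfer A B B k p = 0 := by
  have h := sum_sum_triTransfer_swap A B B S
  linarith

/-- Summing the giving mode over `S` produces the bilinear advection term in the receiving slot:
`Σ_{p∈S} M(A,B,C)(k,p) = Re( conj C(k) · N_S(A,B)(k) )` (cf. `energyRate_eq_re_cdot_advection`).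
[cite: Verma2004MHDTurbulencePhysRep, §3.1] -/
theorem sum_triTransfer_eq_re_cdot (A B C : FourierVelocity) (S : Finset (Fin 3 → ℤ)) (k : Fin 3 → ℤ) :
    ∑ p ∈ S, triTransfer A B C k p = (cdot (fun j => conj (C.coeff k j)) (biAdvection A B S k)).re := by
  unfold triTransfer biAdvection cdot
  have h : ∑ j, conj (C.coeff k j) * (-I * ∑ p ∈ S, kdot k (A.coeff (k - p)) * B.coeff p j) =
      ∑ p ∈ S, (-I) * (kdot k (A.coeff (k - p)) * ∑ j, conj (C.coeff k j) * B.coeff p j) := by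
    simp_rw [Finset.mul_sum]
    rw [Finset.sum_comm]
    refine Finset.sum_congr rfl fun p _ => ?_
    refine Finset.sum_congr rfl fun j _ => ?_
    ring
  rw [h, Complex.re_sum]
  refine Finset.sum_congr rfl fun p _ => ?_
  rw [Complex.mul_re, Complex.neg_re, Complex.neg_im, Complex.I_re, Complex.I_im]
  ring

/-! ## Linear structure on coefficient fields (real scalars keep reality) -/

/-- `A + r • B` for a REAL scalar `r`: again real and incompressible. [folklore] -/
def addSmul (A : FourierVelocity) (r : ℝ) (B : FourierVelocity) : FourierVelocity where
  coeff k j := A.coeff k j + (r : ℂ) * B.coeff k j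
  reality k i := by
    rw [A.reality, B.reality, map_add, map_mul, Complex.conj_ofReal]
  divFree k := by
    have hA := A.divFree k
    have hB := B.divFree k
    have : ∑ i, ((k i : ℤ) : ℂ) * (A.coeff k i + (r : ℂ) * B.coeff k i) =
        ∑ i, ((k i : ℤ) : ℂ) * A.coeff k i + (r : ℂ) * ∑ i, ((k i : ℤ) : ℂ) * B.coeff k i := by
      rw [Finset.mul_sum, ← Finset.sum_add_distrib]
      refine Finset.sum_congr rfl fun i _ => ?_
      ring
    rw [this, hA, hB, mul_zero, add_zero]

/-- The coefficients of `A + r • B`. [folklore] -/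
@[simp] theorem addSmul_coeff (A : FourierVelocity) (r : ℝ) (B : FourierVelocity) (k : Fin 3 → ℤ)
    (j : Fin 3) : (addSmul A r B).coeff k j = A.coeff k j + (r : ℂ) * B.coeff k j := rfl

/-- `M` is additive-homogeneous in the mediator slot (real scalar). [folklore] -/
theorem triTransfer_addSmul_left (A A' B C : FourierVelocity) (r : ℝ) (k p : Fin 3 → ℤ) :
    triTransfer (addSmul A r A') B C k p = triTransfer A B C k p + r * triTransfer A' B C k p := by
  unfold triTransfer
  have hk : kdot k ((addSmul A r A').coeff (k - p)) =
      kdot k (A.coeff (k - p)) + (r : ℂ) * kdot k (A'.coeff (k - p)) := by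
    unfold kdot
    rw [Finset.mul_sum, ← Finset.sum_add_distrib]
    refine Finset.sum_congr rfl fun i _ => ?_
    rw [addSmul_coeff]
    ring
  rw [hk, add_mul, Complex.add_im, mul_assoc, Complex.im_ofReal_mul]

/-- in the giving slot. [folklore] -/
theorem triTransfer_addSmul_mid (A B B' C : FourierVelocity) (r : ℝ) (k p : Fin 3 → ℤ) :
    triTransfer A (addSmul B r B') C k p = triTransfer A B C k p + r * triTransfer A B' C k p := by
  unfold triTransfer
  have hc : cdot (fun i => conj (C.coeff k i)) ((addSmul B r B').coeff p) =
      cdot (fun i => conj (C.coeff k i)) (B.coeff p) + (r : ℂ) * cdot (fun i => conj (C.coeff k i)) (B'.coeff p) := by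
    unfold cdot
    rw [Finset.mul_sum, ← Finset.sum_add_distrib]
    refine Finset.sum_congr rfl fun i _ => ?_
    rw [addSmul_coeff]
    ring
  rw [hc, mul_add, Complex.add_im, mul_left_comm, Complex.im_ofReal_mul]

/-- and in the receiving slot (the scalar is real, so conjugation does not see it). [folklore] -/
theorem triTransfer_addSmul_right (A B C C' : FourierVelocity) (r : ℝ) (k p : Fin 3 → ℤ) :
    triTransfer A B (addSmul C r C') k p = triTransfer A B C k p + r * triTransfer A B C' k p := by
  unfold triTransfer
  have hc : cdot (fun i => conj ((addSmul C r C').coeff k i)) (B.coeff p) =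
      cdot (fun i => conj (C.coeff k i)) (B.coeff p) + (r : ℂ) * cdot (fun i => conj (C'.coeff k i)) (B.coeff p) := by
    unfold cdot
    rw [Finset.mul_sum, ← Finset.sum_add_distrib]
    refine Finset.sum_congr rfl fun i _ => ?_
    simp only [addSmul_coeff, map_add, map_mul, Complex.conj_ofReal]
    ring
  rw [hc, mul_add, Complex.add_im, mul_left_comm, Complex.im_ofReal_mul]

/-! ## The derivative field of a supported Galerkin solution is itself real and incompressible -/

/-- The family `U` is SUPPORTED in `S`: every coefficient off `S` vanishes at all times (as for the
ODE system a pseudo-spectral code integrates — modes outside the resolved set are absent).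
[cite: DoeringGibbon1995, §5.3 (5.3.12)] -/
def IsSupportedOn (U : ℝ → FourierVelocity) (S : Finset (Fin 3 → ℤ)) : Prop :=
  ∀ t, ∀ k ∉ S, (U t).coeff k = 0

/-- The time derivative of every coefficient of a supported Galerkin solution: `galerkinRHS` on `S`,
`0` off `S`. [cite: DoeringGibbon1995, §5.3 (5.3.13)] -/
def rateFun (U : ℝ → FourierVelocity) (S : Finset (Fin 3 → ℤ)) (ν : ℝ) (c : ℝ → (Fin 3 → ℤ) → ℂ)
    (f : ℝ → (Fin 3 → ℤ) → Fin 3 → ℂ) (t : ℝ) (k : Fin 3 → ℤ) (j : Fin 3) : ℂ :=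
  if k ∈ S then galerkinRHS (U t) S ν (c t) (f t) k j else 0

/-- Every coefficient (on or off `S`) is differentiable in time with derivative `rateFun`. [folklore] -/
theorem hasDerivAt_coeff {U : ℝ → FourierVelocity} {S : Finset (Fin 3 → ℤ)} {ν : ℝ}
    {c : ℝ → (Fin 3 → ℤ) → ℂ} {f : ℝ → (Fin 3 → ℤ) → Fin 3 → ℂ} (hU : IsGalerkinSolution U S ν c f)
    (hsupp : IsSupportedOn U S) (t : ℝ) (k : Fin 3 → ℤ) (j : Fin 3) :
    HasDerivAt (fun s => (U s).coeff k j) (rateFun U S ν c f t k j) t := by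
  unfold rateFun
  by_cases hk : k ∈ S
  · rw [if_pos hk]; exact hU t k hk j
  · rw [if_neg hk]
    have e : (fun s => (U s).coeff k j) = fun _ => (0 : ℂ) := by
      funext s; rw [hsupp s k hk]; rfl
    rw [e]; exact hasDerivAt_const t 0

/-- **Reality is inherited by the time derivative**: `d/dt û(-k) = conj d/dt û(k)` (both sides are
derivatives of the same function, by reality at every time and uniqueness of the derivative). [folklore] -/
theorem rateFun_reality {U : ℝ → FourierVelocity} {S : Finset (Fin 3 → ℤ)} {ν : ℝ}
    {c : ℝ → (Fin 3 → ℤ) → ℂ} {f : ℝ → (Fin 3 → ℤ) → Fin 3 → ℂ} (hU : IsGalerkinSolution U S ν c f)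
    (hsupp : IsSupportedOn U S) (t : ℝ) (k : Fin 3 → ℤ) (i : Fin 3) :
    rateFun U S ν c f t (-k) i = conj (rateFun U S ν c f t k i) := by
  have h1 := hasDerivAt_coeff hU hsupp t (-k) i
  have h2 : HasDerivAt (fun s => (U s).coeff (-k) i) (conj (rateFun U S ν c f t k i)) t := by
    have e : (fun s => (U s).coeff (-k) i) = fun s => conj ((U s).coeff k i) :=
      funext fun s => (U s).reality k i
    rw [e]
    exact (hasDerivAt_coeff hU hsupp t k i).star
  exact h1.unique h2

/-- **Incompressibility is inherited by the time derivative**: `k · d/dt û(k) = 0` (the derivative of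
the identically vanishing function `t ↦ k·û(k,t)`). This is what DETERMINES the pressure multiplier
along a solution: `c(k)|k|² = k·N_S(k) + k·f̂(k)`. [cite: DoeringGibbon1995, §5.3 (5.3.14)] -/
theorem rateFun_divFree {U : ℝ → FourierVelocity} {S : Finset (Fin 3 → ℤ)} {ν : ℝ}
    {c : ℝ → (Fin 3 → ℤ) → ℂ} {f : ℝ → (Fin 3 → ℤ) → Fin 3 → ℂ} (hU : IsGalerkinSolution U S ν c f)
    (hsupp : IsSupportedOn U S) (t : ℝ) (k : Fin 3 → ℤ) :
    ∑ i, ((k i : ℤ) : ℂ) * rateFun U S ν c f t k i = 0 := by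
  have h1 : HasDerivAt (fun s => ∑ i, ((k i : ℤ) : ℂ) * (U s).coeff k i)
      (∑ i, ((k i : ℤ) : ℂ) * rateFun U S ν c f t k i) t :=
    HasDerivAt.fun_sum fun i _ => (hasDerivAt_coeff hU hsupp t k i).const_mul _
  have h2 : HasDerivAt (fun s => ∑ i, ((k i : ℤ) : ℂ) * (U s).coeff k i) 0 t := by
    have e : (fun s => ∑ i, ((k i : ℤ) : ℂ) * (U s).coeff k i) = fun _ => (0 : ℂ) :=
      funext fun s => (U s).divFree k
    rw [e]; exact hasDerivAt_const t 0
  exact h1.unique h2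

/-- **The derivative field** `U̇(t)` of a supported Galerkin solution, as a `FourierVelocity`. [folklore] -/
def rateField {U : ℝ → FourierVelocity} {S : Finset (Fin 3 → ℤ)} {ν : ℝ}
    {c : ℝ → (Fin 3 → ℤ) → ℂ} {f : ℝ → (Fin 3 → ℤ) → Fin 3 → ℂ} (hU : IsGalerkinSolution U S ν c f)
    (hsupp : IsSupportedOn U S) (t : ℝ) : FourierVelocity where
  coeff := rateFun U S ν c f t
  reality k i := rateFun_reality hU hsupp t k i
  divFree k := rateFun_divFree hU hsupp t k

/-- Its coefficients. [folklore] -/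
theorem rateField_coeff {U : ℝ → FourierVelocity} {S : Finset (Fin 3 → ℤ)} {ν : ℝ}
    {c : ℝ → (Fin 3 → ℤ) → ℂ} {f : ℝ → (Fin 3 → ℤ) → Fin 3 → ℂ} (hU : IsGalerkinSolution U S ν c f)
    (hsupp : IsSupportedOn U S) (t : ℝ) :
    (rateField hU hsupp t).coeff = rateFun U S ν c f t := rfl

/-! ## Time derivative of the mode-to-mode transfer along a solution -/

/-- `d/dt M(U,U,U)(k,p) = M(U̇,U,U) + M(U,U̇,U) + M(U,U,U̇)` (product rule on the trilinear form).
[folklore] -/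
theorem hasDerivAt_modeTransfer {U : ℝ → FourierVelocity} {S : Finset (Fin 3 → ℤ)} {ν : ℝ}
    {c : ℝ → (Fin 3 → ℤ) → ℂ} {f : ℝ → (Fin 3 → ℤ) → Fin 3 → ℂ} (hU : IsGalerkinSolution U S ν c f)
    (hsupp : IsSupportedOn U S) (t : ℝ) (k p : Fin 3 → ℤ) :
    HasDerivAt (fun s => modeTransfer (U s) k p)
      (triTransfer (rateField hU hsupp t) (U t) (U t) k p + triTransfer (U t) (rateField hU hsupp t) (U t) k p +
        triTransfer (U t) (U t) (rateField hU hsupp t) k p) t := by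
  -- the two complex factors and their derivatives
  have hA : HasDerivAt (fun s => kdot k ((U s).coeff (k - p))) (kdot k (rateFun U S ν c f t (k - p))) t := by
    unfold kdot
    exact HasDerivAt.fun_sum fun i _ => (hasDerivAt_coeff hU hsupp t (k - p) i).const_mul _
  have hB : HasDerivAt (fun s => cdot (fun i => conj ((U s).coeff k i)) ((U s).coeff p))
      (cdot (fun i => conj (rateFun U S ν c f t k i)) ((U t).coeff p) +
        cdot (fun i => conj ((U t).coeff k i)) (rateFun U S ν c f t p)) t := by
    unfold cdot
    rw [← Finset.sum_add_distrib]
    refine HasDerivAt.fun_sum fun i _ => ?_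
    have h1 : HasDerivAt (fun s => conj ((U s).coeff k i)) (conj (rateFun U S ν c f t k i)) t :=
      (hasDerivAt_coeff hU hsupp t k i).star
    have h2 := hasDerivAt_coeff hU hsupp t p i
    exact h1.fun_mul h2
  have hprod := hA.fun_mul hB
  have him : HasDerivAt (fun s => (kdot k ((U s).coeff (k - p)) *
      cdot (fun i => conj ((U s).coeff k i)) ((U s).coeff p)).im)
      ((kdot k (rateFun U S ν c f t (k - p)) * cdot (fun i => conj ((U t).coeff k i)) ((U t).coeff p) +
        kdot k ((U t).coeff (k - p)) * (cdot (fun i => conj (rateFun U S ν c f t k i)) ((U t).coeff p) +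
          cdot (fun i => conj ((U t).coeff k i)) (rateFun U S ν c f t p))).im) t :=
    Complex.imCLM.hasFDerivAt.comp_hasDerivAt t hprod
  unfold modeTransfer triTransfer
  rw [rateField_coeff]
  refine him.congr_deriv ?_
  rw [mul_add, Complex.add_im, Complex.add_im]
  ring

/-- `d/dt T(k) = Σ_{p∈S} [M(U̇,U,U) + M(U,U̇,U) + M(U,U,U̇)](k,p)` for the net transfer
`T(k) = energyRate`. [folklore] -/
theorem hasDerivAt_energyRate {U : ℝ → FourierVelocity} {S : Finset (Fin 3 → ℤ)} {ν : ℝ}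
    {c : ℝ → (Fin 3 → ℤ) → ℂ} {f : ℝ → (Fin 3 → ℤ) → Fin 3 → ℂ} (hU : IsGalerkinSolution U S ν c f)
    (hsupp : IsSupportedOn U S) (t : ℝ) (k : Fin 3 → ℤ) :
    HasDerivAt (fun s => energyRate (U s) S k)
      (∑ p ∈ S, (triTransfer (rateField hU hsupp t) (U t) (U t) k p +
        triTransfer (U t) (rateField hU hsupp t) (U t) k p +
          triTransfer (U t) (U t) (rateField hU hsupp t) k p)) t := by
  unfold energyRate
  exact HasDerivAt.fun_sum fun p _ => hasDerivAt_modeTransfer hU hsupp t k p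

/-- **Time derivative of the nonlinear enstrophy production** along a supported Galerkin solution:
`d/dt T_Z = Σ_{k∈S} |k|² Σ_{p∈S} [M(U̇,U,U) + M(U,U̇,U) + M(U,U,U̇)](k,p)`. [folklore] -/
theorem hasDerivAt_enstrophyTransfer {U : ℝ → FourierVelocity} {S : Finset (Fin 3 → ℤ)} {ν : ℝ}
    {c : ℝ → (Fin 3 → ℤ) → ℂ} {f : ℝ → (Fin 3 → ℤ) → Fin 3 → ℂ} (hU : IsGalerkinSolution U S ν c f)
    (hsupp : IsSupportedOn U S) (t : ℝ) :
    HasDerivAt (fun s => enstrophyTransfer (U s) S)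
      (∑ k ∈ S, knormSq k * ∑ p ∈ S, (triTransfer (rateField hU hsupp t) (U t) (U t) k p +
        triTransfer (U t) (rateField hU hsupp t) (U t) k p +
          triTransfer (U t) (U t) (rateField hU hsupp t) k p)) t := by
  unfold enstrophyTransfer
  exact HasDerivAt.fun_sum fun k _ => (hasDerivAt_energyRate hU hsupp t k).const_mul _

/-- **Time derivative of the palinstrophy** along a Galerkin solution (the `|k|⁴`-moment of the
modal energy equation): `d/dt P_S = Σ_{k∈S} |k|⁴ (-2ν|k|² E(k) + T(k) + Re(conj û(k)·f̂(k)))`.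
[cite: Verma2004MHDTurbulencePhysRep, §3.4] -/
theorem hasDerivAt_truncPalinstrophy {U : ℝ → FourierVelocity} {S : Finset (Fin 3 → ℤ)} {ν : ℝ}
    {c : ℝ → (Fin 3 → ℤ) → ℂ} {f : ℝ → (Fin 3 → ℤ) → Fin 3 → ℂ} (hU : IsGalerkinSolution U S ν c f)
    (t : ℝ) :
    HasDerivAt (fun s => truncPalinstrophy (U s) S)
      (∑ k ∈ S, knormSq k ^ 2 * (-(2 * ν * knormSq k) * modalEnergy (U t) k + energyRate (U t) S k +
        (cdot (fun j => conj ((U t).coeff k j)) (f t k)).re)) t := by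
  unfold truncPalinstrophy
  exact HasDerivAt.fun_sum fun k hk => (hasDerivAt_modalEnergy_galerkin hU t hk).const_mul _

/-! ## Evaluation at a single-shell instant

At an instant `t` at which the (unforced, supported) solution is carried by one shell `|k|² = λ`,
write the derivative field as `U̇ = -νλ U + W`: the INVISCID RATE FIELD `W` (`= N_S(k) - c(k) k` on
`S`, `0` off `S`; real and incompressible because `U̇` and `U` are) is the Leray-projected truncated
advection term, `W(k) = P_k N_S(k)`. The three polarised transfer sums then evaluate by detailed
conservation and the single-shell weights `|k|² ↦ λ`:
`Σ|k|²Σ M(W,U,U) = 0`, `Σ|k|²Σ M(U,W,U) = -2λ E_S(W)`, `Σ|k|²Σ M(U,U,W) = 2 Z_S(W)`, the `-νλU` parts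
give `-3νλ T_Z = 0`, and `dP_S/dt = -2νλ² Z_S`. [folklore]
-/

/-- The **inviscid rate field** at a single-shell instant: `W = U̇ + νλ U`. [folklore] -/
def inviscidRate {U : ℝ → FourierVelocity} {S : Finset (Fin 3 → ℤ)} {ν : ℝ}
    {c : ℝ → (Fin 3 → ℤ) → ℂ} {f : ℝ → (Fin 3 → ℤ) → Fin 3 → ℂ} (hU : IsGalerkinSolution U S ν c f)
    (hsupp : IsSupportedOn U S) (t : ℝ) (lam : ℝ) : FourierVelocity :=
  addSmul (rateField hU hsupp t) (ν * lam) (U t)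

/-- A mode with zero receiving coefficient receives nothing: `C(k) = 0 ⇒ M(A,B,C)(k,p) = 0`. [folklore] -/
theorem triTransfer_eq_zero_of_coeff (A B C : FourierVelocity) {k : Fin 3 → ℤ} (hk : C.coeff k = 0)
    (p : Fin 3 → ℤ) : triTransfer A B C k p = 0 := by
  unfold triTransfer cdot
  simp [hk]

/-- **Single-shell weights**: if the receiving field `C` is single-shell with `|k|² = λ`, then
`Σ_{k∈S} |k|² Σ_{p∈S} M(A,B,C)(k,p) = λ Σ_{k∈S} Σ_{p∈S} M(A,B,C)(k,p)`. [folklore] -/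
theorem sum_knormSq_mul_sum_triTransfer (A B C : FourierVelocity) (S : Finset (Fin 3 → ℤ)) {lam : ℝ}
    (h : IsSingleShell C lam) :
    ∑ k ∈ S, knormSq k * ∑ p ∈ S, triTransfer A B C k p = lam * ∑ k ∈ S, ∑ p ∈ S, triTransfer A B C k p := by
  rw [Finset.mul_sum]
  refine Finset.sum_congr rfl fun k _ => ?_
  by_cases hk : C.coeff k = 0
  · rw [Finset.sum_congr rfl fun p _ => triTransfer_eq_zero_of_coeff A B C hk p, Finset.sum_const_zero,
      mul_zero, mul_zero]
  · rw [h k hk]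

/-- `Σ_i k_i k_i = |k|²` as a complex number. [folklore] -/
theorem sum_intCast_mul_self (k : Fin 3 → ℤ) : ∑ i, ((k i : ℤ) : ℂ) * ((k i : ℤ) : ℂ) = (knormSq k : ℂ) := by
  unfold knormSq
  push_cast
  refine Finset.sum_congr rfl fun i _ => ?_
  ring

/-- `|k|² = 0 ↔ k = 0`. [folklore] -/
theorem knormSq_eq_zero_iff (k : Fin 3 → ℤ) : knormSq k = 0 ↔ k = 0 := by
  constructor
  · intro h
    unfold knormSq at h
    rw [Finset.sum_eq_zero_iff_of_nonneg fun i _ => sq_nonneg _] at h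
    funext i
    have hi := h i (Finset.mem_univ i)
    have : ((k i : ℤ) : ℝ) = 0 := pow_eq_zero_iff (n := 2) (by norm_num) |>.mp hi
    exact_mod_cast this
  · rintro rfl
    simp [knormSq]

/-- **The Leray projection** of a vector `a ∈ ℂ³` at wavevector `k`: `P_k a = a - ((k·a)/|k|²) k`
(`= a` at `k = 0`, where Lean's `x/0 = 0` applies and nothing is carried anyway). [folklore] -/
def leray (k : Fin 3 → ℤ) (a : Fin 3 → ℂ) : Fin 3 → ℂ :=
  fun j => a j - kdot k a / (knormSq k : ℂ) * ((k j : ℤ) : ℂ)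

/-- Unfolding lemma. [folklore] -/
theorem leray_apply (k : Fin 3 → ℤ) (a : Fin 3 → ℂ) (j : Fin 3) :
    leray k a j = a j - kdot k a / (knormSq k : ℂ) * ((k j : ℤ) : ℂ) := rfl

/-- `P_k 0 = 0`. [folklore] -/
theorem leray_zero (k : Fin 3 → ℤ) : leray k 0 = 0 := by
  funext j
  rw [leray_apply]
  unfold kdot
  simp

/-- The **inviscid enstrophy-curvature functional** of a truncated field on `S` relative to the shell
value `λ`: `Q_S(û) = Σ_{k∈S} (|k|² - λ) |P_k N_S(k)|²` — the enstrophy production switched on by the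
modes that the Leray-projected advection term excites, weighted by their distance from the shell.
[folklore] -/
def curvatureQ (V : FourierVelocity) (S : Finset (Fin 3 → ℤ)) (lam : ℝ) : ℝ :=
  ∑ k ∈ S, (knormSq k - lam) * ∑ j, Complex.normSq (leray k (advection V S k) j)

section SingleShell

variable {U : ℝ → FourierVelocity} {S : Finset (Fin 3 → ℤ)} {ν : ℝ} {c : ℝ → (Fin 3 → ℤ) → ℂ}
  (hU : IsGalerkinSolution U S ν c fun _ _ _ => 0) (hsupp : IsSupportedOn U S) (t : ℝ) {lam : ℝ}
  (h : IsSingleShell (U t) lam)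
include hU hsupp h

/-- On `S` the inviscid rate field is the truncated advection term minus the pressure multiple of `k`:
`W(k) = N_S(k) - c(k) k` (the viscous term `-ν|k|²û(k)` is exactly cancelled by `+νλ û(k)` on a
single shell). [folklore] -/
theorem inviscidRate_coeff_of_mem {k : Fin 3 → ℤ} (hk : k ∈ S) (j : Fin 3) :
    (inviscidRate hU hsupp t lam).coeff k j = advection (U t) S k j - c t k * ((k j : ℤ) : ℂ) := by
  show rateFun U S ν c (fun _ _ _ => 0) t k j + ((ν * lam : ℝ) : ℂ) * (U t).coeff k j = _
  unfold rateFun galerkinRHS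
  rw [if_pos hk]
  by_cases hz : (U t).coeff k = 0
  · rw [hz]; simp
  · rw [h k hz]; push_cast; ring

omit h in
/-- Off `S` it vanishes. [folklore] -/
theorem inviscidRate_coeff_of_not_mem {k : Fin 3 → ℤ} (hk : k ∉ S) :
    (inviscidRate hU hsupp t lam).coeff k = 0 := by
  funext j
  show rateFun U S ν c (fun _ _ _ => 0) t k j + ((ν * lam : ℝ) : ℂ) * (U t).coeff k j = 0
  unfold rateFun
  rw [if_neg hk, hsupp t k hk]
  simp

/-- The pressure multiplier is DETERMINED along the solution: `c(k)|k|² = k · N_S(k)` for `k ∈ S`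
(incompressibility of the rate field). [cite: DoeringGibbon1995, §5.3 (5.3.14)] -/
theorem pressure_mul_knormSq {k : Fin 3 → ℤ} (hk : k ∈ S) :
    c t k * (knormSq k : ℂ) = kdot k (advection (U t) S k) := by
  have hdiv := (inviscidRate hU hsupp t lam).divFree k
  simp_rw [inviscidRate_coeff_of_mem hU hsupp t h hk] at hdiv
  unfold kdot
  rw [← sum_intCast_mul_self, Finset.mul_sum]
  have : ∑ i, ((k i : ℤ) : ℂ) * (advection (U t) S k i - c t k * ((k i : ℤ) : ℂ)) =
      ∑ i, ((k i : ℤ) : ℂ) * advection (U t) S k i - ∑ i, c t k * (((k i : ℤ) : ℂ) * ((k i : ℤ) : ℂ)) := by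
    rw [← Finset.sum_sub_distrib]
    refine Finset.sum_congr rfl fun i _ => ?_
    ring
  rw [this] at hdiv
  exact (sub_eq_zero.mp hdiv).symm

/-- **`W(k) = P_k N_S(k)`**: on `S` the inviscid rate field is the Leray-projected truncated advection
term. [cite: DoeringGibbon1995, §5.3 (5.3.13)–(5.3.14)] -/
theorem inviscidRate_coeff_eq_leray {k : Fin 3 → ℤ} (hk : k ∈ S) (j : Fin 3) :
    (inviscidRate hU hsupp t lam).coeff k j = leray k (advection (U t) S k) j := by
  rw [inviscidRate_coeff_of_mem hU hsupp t h hk, leray_apply, ← pressure_mul_knormSq hU hsupp t h hk]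
  by_cases hk0 : knormSq k = 0
  · have : k = 0 := (knormSq_eq_zero_iff k).mp hk0
    subst this
    simp
  · have : (knormSq k : ℂ) ≠ 0 := by exact_mod_cast hk0
    rw [mul_div_assoc, div_self this, mul_one]

/-- `Re( conj W(k) · N_S(k) ) = Σ_j |W_j(k)|² = 2 E_W(k)` for `k ∈ S`: against the incompressible `W(k)`
the pressure part of `N_S(k) = W(k) + c(k) k` drops out. [folklore] -/
theorem re_cdot_inviscidRate_advection {k : Fin 3 → ℤ} (hk : k ∈ S) :
    (cdot (fun j => conj ((inviscidRate hU hsupp t lam).coeff k j)) (advection (U t) S k)).re =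
      2 * modalEnergy (inviscidRate hU hsupp t lam) k := by
  set W := inviscidRate hU hsupp t lam with hW
  have hadv : advection (U t) S k = fun j => W.coeff k j + c t k * ((k j : ℤ) : ℂ) := by
    funext j
    rw [hW, inviscidRate_coeff_of_mem hU hsupp t h hk]
    ring
  have hsplit : cdot (fun j => conj (W.coeff k j)) (advection (U t) S k) =
      ∑ j, conj (W.coeff k j) * W.coeff k j + cdot (fun j => conj (W.coeff k j)) (fun j => c t k * ((k j : ℤ) : ℂ)) := by
    rw [hadv]
    unfold cdot
    rw [← Finset.sum_add_distrib]
    refine Finset.sum_congr rfl fun j _ => ?_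
    ring
  rw [hsplit, cdot_conj_coeff_parallel, add_zero]
  unfold modalEnergy
  have hns : ∑ j, conj (W.coeff k j) * W.coeff k j = ((∑ j, Complex.normSq (W.coeff k j) : ℝ) : ℂ) := by
    rw [Complex.ofReal_sum]
    refine Finset.sum_congr rfl fun j _ => ?_
    rw [Complex.normSq_eq_conj_mul_self]
  rw [hns, Complex.ofReal_re]
  ring

/-- First polarised sum: `Σ_{k∈S}|k|² Σ_{p∈S} M(W,U,U)(k,p) = 0` (single-shell weight `λ`, then detailed
conservation with the mediator `W`). [folklore] -/
theorem sum_triTransfer_rate_left :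
    ∑ k ∈ S, knormSq k * ∑ p ∈ S, triTransfer (inviscidRate hU hsupp t lam) (U t) (U t) k p = 0 := by
  rw [sum_knormSq_mul_sum_triTransfer _ _ _ S h, sum_sum_triTransfer_eq_zero, mul_zero]

/-- Third polarised sum: `Σ_{k∈S}|k|² Σ_{p∈S} M(U,U,W)(k,p) = 2 Z_S(W)`. [folklore] -/
theorem sum_triTransfer_rate_right :
    ∑ k ∈ S, knormSq k * ∑ p ∈ S, triTransfer (U t) (U t) (inviscidRate hU hsupp t lam) k p =
      2 * truncEnstrophy (inviscidRate hU hsupp t lam) S := by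
  unfold truncEnstrophy
  rw [Finset.mul_sum]
  refine Finset.sum_congr rfl fun k hk => ?_
  rw [sum_triTransfer_eq_re_cdot, biAdvection_self, re_cdot_inviscidRate_advection hU hsupp t h hk]
  ring

/-- Second polarised sum: `Σ_{k∈S}|k|² Σ_{p∈S} M(U,W,U)(k,p) = -2λ E_S(W)` (single-shell weight, then the
giving/receiving exchange `sum_sum_triTransfer_swap`). [folklore] -/
theorem sum_triTransfer_rate_mid :
    ∑ k ∈ S, knormSq k * ∑ p ∈ S, triTransfer (U t) (inviscidRate hU hsupp t lam) (U t) k p =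
      -(2 * lam) * truncEnergy (inviscidRate hU hsupp t lam) S := by
  rw [sum_knormSq_mul_sum_triTransfer _ _ _ S h, sum_sum_triTransfer_swap]
  unfold truncEnergy
  rw [mul_neg, Finset.mul_sum, Finset.mul_sum, ← Finset.sum_neg_distrib]
  refine Finset.sum_congr rfl fun k hk => ?_
  rw [sum_triTransfer_eq_re_cdot, biAdvection_self, re_cdot_inviscidRate_advection hU hsupp t h hk]
  ring

/-- The viscous parts of the three slots: `Σ|k|²Σ [M(U̇,U,U)+M(U,U̇,U)+M(U,U,U̇)]` equals the same with
`W` in place of `U̇`, because the difference is `-3νλ T_Z = 0` on a single shell. [folklore] -/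
theorem sum_triTransfer_rateField_eq :
    ∑ k ∈ S, knormSq k * ∑ p ∈ S, (triTransfer (rateField hU hsupp t) (U t) (U t) k p +
        triTransfer (U t) (rateField hU hsupp t) (U t) k p +
          triTransfer (U t) (U t) (rateField hU hsupp t) k p) =
      2 * truncEnstrophy (inviscidRate hU hsupp t lam) S
        - 2 * lam * truncEnergy (inviscidRate hU hsupp t lam) S := by
  -- `W = U̇ + νλ U`, so every slot with `U̇` is the slot with `W` minus `νλ ×` the slot with `U`
  have hL : ∀ k p, triTransfer (rateField hU hsupp t) (U t) (U t) k p =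
      triTransfer (inviscidRate hU hsupp t lam) (U t) (U t) k p - ν * lam * modeTransfer (U t) k p := by
    intro k p
    have := triTransfer_addSmul_left (rateField hU hsupp t) (U t) (U t) (U t) (ν * lam) k p
    rw [triTransfer_self] at this
    unfold inviscidRate
    linarith
  have hM : ∀ k p, triTransfer (U t) (rateField hU hsupp t) (U t) k p =
      triTransfer (U t) (inviscidRate hU hsupp t lam) (U t) k p - ν * lam * modeTransfer (U t) k p := by
    intro k p
    have := triTransfer_addSmul_mid (U t) (rateField hU hsupp t) (U t) (U t) (ν * lam) k p
    rw [triTransfer_self] at this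
    unfold inviscidRate
    linarith
  have hR : ∀ k p, triTransfer (U t) (U t) (rateField hU hsupp t) k p =
      triTransfer (U t) (U t) (inviscidRate hU hsupp t lam) k p - ν * lam * modeTransfer (U t) k p := by
    intro k p
    have := triTransfer_addSmul_right (U t) (U t) (rateField hU hsupp t) (U t) (ν * lam) k p
    rw [triTransfer_self] at this
    unfold inviscidRate
    linarith
  have hTZ : enstrophyTransfer (U t) S = 0 := enstrophyTransfer_eq_zero_of_singleShell (U t) S h
  unfold enstrophyTransfer energyRate at hTZ
  have e1 : ∑ k ∈ S, knormSq k * ∑ p ∈ S, (triTransfer (rateField hU hsupp t) (U t) (U t) k p +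
        triTransfer (U t) (rateField hU hsupp t) (U t) k p +
          triTransfer (U t) (U t) (rateField hU hsupp t) k p) =
      ∑ k ∈ S, (knormSq k * ∑ p ∈ S, triTransfer (inviscidRate hU hsupp t lam) (U t) (U t) k p +
        knormSq k * ∑ p ∈ S, triTransfer (U t) (inviscidRate hU hsupp t lam) (U t) k p +
        knormSq k * ∑ p ∈ S, triTransfer (U t) (U t) (inviscidRate hU hsupp t lam) k p -
        3 * (ν * lam) * (knormSq k * ∑ p ∈ S, modeTransfer (U t) k p)) := by
    refine Finset.sum_congr rfl fun k _ => ?_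
    rw [← mul_add, ← mul_add, ← Finset.sum_add_distrib, ← Finset.sum_add_distrib]
    have e3 : 3 * (ν * lam) * (knormSq k * ∑ p ∈ S, modeTransfer (U t) k p) =
        knormSq k * ∑ p ∈ S, 3 * (ν * lam) * modeTransfer (U t) k p := by
      rw [Finset.mul_sum, Finset.mul_sum, Finset.mul_sum]
      refine Finset.sum_congr rfl fun p _ => ?_
      ring
    rw [e3, ← mul_sub, ← Finset.sum_sub_distrib]
    congr 1
    refine Finset.sum_congr rfl fun p _ => ?_
    rw [hL, hM, hR]
    ring
  rw [e1, Finset.sum_sub_distrib, Finset.sum_add_distrib, Finset.sum_add_distrib, ← Finset.mul_sum, hTZ,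
    mul_zero, sub_zero, sum_triTransfer_rate_left hU hsupp t h, sum_triTransfer_rate_mid hU hsupp t h,
    sum_triTransfer_rate_right hU hsupp t h]
  ring

omit hsupp in
/-- `dP_S/dt = -2νλ² Z_S` at a single-shell instant (unforced). [folklore] -/
theorem hasDerivAt_truncPalinstrophy_singleShell :
    HasDerivAt (fun s => truncPalinstrophy (U s) S) (-(2 * ν * lam ^ 2) * truncEnstrophy (U t) S) t := by
  have hd := hasDerivAt_truncPalinstrophy hU t
  refine hd.congr_deriv ?_
  have hterm : ∀ k ∈ S, knormSq k ^ 2 * (-(2 * ν * knormSq k) * modalEnergy (U t) k + energyRate (U t) S k +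
      (cdot (fun j => conj ((U t).coeff k j)) (fun _ => (0 : ℂ))).re) =
      -(2 * ν * lam ^ 2) * (knormSq k * modalEnergy (U t) k) + lam ^ 2 * energyRate (U t) S k := by
    intro k _
    have h0 : (cdot (fun j => conj ((U t).coeff k j)) (fun _ => (0 : ℂ))).re = 0 := by
      unfold cdot; simp
    rw [h0, add_zero]
    by_cases hz : (U t).coeff k = 0
    · rw [modalEnergy_eq_zero_of_coeff (U t) hz, energyRate_eq_zero_of_coeff (U t) S hz]
      ring
    · rw [h k hz]
      ring
  rw [Finset.sum_congr rfl hterm, Finset.sum_add_distrib, ← Finset.mul_sum, ← Finset.mul_sum]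
  unfold truncEnstrophy
  have hT : ∑ k ∈ S, energyRate (U t) S k = 0 := sum_energyRate_eq_zero (U t) S
  rw [hT, mul_zero, add_zero]

/-- **THE ENSTROPHY CURVATURE AT A SINGLE-SHELL INSTANT.** Along an unforced Galerkin solution
supported in `S`, at an instant `t` where the field is carried by one shell `|k|² = λ`, the time
derivative of the enstrophy rate `Ż_S = -2ν P_S + T_Z` is
`Z̈_S = 4ν²λ² Z_S + 2 Z_S(W) - 2λ E_S(W)`, `W = P N_S` the inviscid rate field. (The `ν²` term is
pure single-shell decay `Z_S e^{-2νλt}`; there is NO `O(ν)` cross term; the inviscid part is the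
first appearance of enstrophy production, through the modes `W` excites.) [folklore] -/
theorem hasDerivAt_enstrophyRate_singleShell :
    HasDerivAt (fun s => -(2 * ν) * truncPalinstrophy (U s) S + enstrophyTransfer (U s) S)
      (4 * ν ^ 2 * lam ^ 2 * truncEnstrophy (U t) S +
        (2 * truncEnstrophy (inviscidRate hU hsupp t lam) S
          - 2 * lam * truncEnergy (inviscidRate hU hsupp t lam) S)) t := by
  have hP := (hasDerivAt_truncPalinstrophy_singleShell hU t h).const_mul (-(2 * ν))
  have hT := hasDerivAt_enstrophyTransfer hU hsupp t
  rw [sum_triTransfer_rateField_eq hU hsupp t h] at hT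
  have hsum : HasDerivAt (fun s => -(2 * ν) * truncPalinstrophy (U s) S + enstrophyTransfer (U s) S)
      (-(2 * ν) * (-(2 * ν * lam ^ 2) * truncEnstrophy (U t) S) +
        (2 * truncEnstrophy (inviscidRate hU hsupp t lam) S
          - 2 * lam * truncEnergy (inviscidRate hU hsupp t lam) S)) t := hP.add hT
  refine hsum.congr_deriv ?_
  ring

/-- The same with `Z_S` itself: the enstrophy is twice differentiable along the solution and
`(deriv Z_S)' (t) = 4ν²λ² Z_S + 2 Z_S(W) - 2λ E_S(W)`. [folklore] -/
theorem hasDerivAt_deriv_truncEnstrophy_singleShell :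
    HasDerivAt (deriv fun s => truncEnstrophy (U s) S)
      (4 * ν ^ 2 * lam ^ 2 * truncEnstrophy (U t) S +
        (2 * truncEnstrophy (inviscidRate hU hsupp t lam) S
          - 2 * lam * truncEnergy (inviscidRate hU hsupp t lam) S)) t := by
  have e : deriv (fun s => truncEnstrophy (U s) S) =
      fun s => -(2 * ν) * truncPalinstrophy (U s) S + enstrophyTransfer (U s) S := by
    funext s
    have hs := (hasDerivAt_truncEnstrophy_galerkin hU s).deriv
    rw [hs]
    have h0 : enstrophyInjection (U s) ((fun _ _ _ => (0 : ℂ)) s) S = 0 := by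
      unfold enstrophyInjection cdot; simp
    rw [h0, add_zero]
  rw [e]
  exact hasDerivAt_enstrophyRate_singleShell hU hsupp t h

/-- **Closed form of the inviscid part**: `2 Z_S(W) - 2λ E_S(W) = Q_S(û(t)) = Σ_{k∈S} (|k|²-λ)|P_k N_S(k)|²`.
[folklore] -/
theorem inviscidRate_curvature_eq_curvatureQ :
    2 * truncEnstrophy (inviscidRate hU hsupp t lam) S - 2 * lam * truncEnergy (inviscidRate hU hsupp t lam) S =
      curvatureQ (U t) S lam := by
  unfold truncEnstrophy truncEnergy curvatureQ
  rw [Finset.mul_sum, Finset.mul_sum, ← Finset.sum_sub_distrib]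
  refine Finset.sum_congr rfl fun k hk => ?_
  have hE : 2 * modalEnergy (inviscidRate hU hsupp t lam) k =
      ∑ j, Complex.normSq (leray k (advection (U t) S k) j) := by
    unfold modalEnergy
    rw [Finset.sum_congr rfl fun j _ => by rw [inviscidRate_coeff_eq_leray hU hsupp t h hk j]]
    ring
  rw [← hE]
  ring

/-- **THE ENSTROPHY CURVATURE AT A SINGLE-SHELL INSTANT, closed form**:
`Z̈_S(t) = 4ν²λ² Z_S(t) + Σ_{k∈S} (|k|² - λ) |P_k N_S(k)|²`. [folklore] -/
theorem hasDerivAt_deriv_truncEnstrophy_singleShell' :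
    HasDerivAt (deriv fun s => truncEnstrophy (U s) S)
      (4 * ν ^ 2 * lam ^ 2 * truncEnstrophy (U t) S + curvatureQ (U t) S lam) t := by
  rw [← inviscidRate_curvature_eq_curvatureQ hU hsupp t h]
  exact hasDerivAt_deriv_truncEnstrophy_singleShell hU hsupp t h

/-- The rate form: `d/dt (-2ν P_S + T_Z) (t) = 4ν²λ² Z_S(t) + Q_S(û(t))`. [folklore] -/
theorem hasDerivAt_enstrophyRate_singleShell' :
    HasDerivAt (fun s => -(2 * ν) * truncPalinstrophy (U s) S + enstrophyTransfer (U s) S)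
      (4 * ν ^ 2 * lam ^ 2 * truncEnstrophy (U t) S + curvatureQ (U t) S lam) t := by
  rw [← inviscidRate_curvature_eq_curvatureQ hU hsupp t h]
  exact hasDerivAt_enstrophyRate_singleShell hU hsupp t h

end SingleShell

/-- Truncated EULER at a single-shell instant: `Ż_S = 0` (GalerkinEnergyBalance v3) and
`Z̈_S = Q_S(û) = Σ_{k∈S} (|k|² - λ)|P_k N_S(k)|²` — the enstrophy curve leaves every classical lattice
datum as an even parabola whose curvature is this finite triad sum. [folklore] -/
theorem hasDerivAt_deriv_truncEnstrophy_singleShell_euler {U : ℝ → FourierVelocity}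
    {S : Finset (Fin 3 → ℤ)} {c : ℝ → (Fin 3 → ℤ) → ℂ}
    (hU : IsGalerkinSolution U S 0 c fun _ _ _ => 0) (hsupp : IsSupportedOn U S) (t : ℝ) {lam : ℝ}
    (h : IsSingleShell (U t) lam) :
    HasDerivAt (deriv fun s => truncEnstrophy (U s) S) (curvatureQ (U t) S lam) t := by
  have hd := hasDerivAt_deriv_truncEnstrophy_singleShell' hU hsupp t h
  simpa using hd


end ShellTransfer

end Literature.Analysis.FluidPDE.FluidComputer

end
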